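import Summits.QuantumAdvantage.QuantumAdvantage.Theorems.CharDialTokenDialB
import Summits.QuantumAdvantage.QuantumAdvantage.Theorems.CharDialTowerE
import HarnessLib

/-!
# CharDial tower — the TOKEN DIAL, part C: the six-dial split of T by name, and its certificates

Cell `decomp-qadv`, lens 6, generation 19; supports stmt-QuantumAdvantage-27206 / 27207 / 32604.  Imports part B (Theses-free) and
`CharDialTowerE` (hence `Theses.CharDial`); nothing cell-side is imported by the route file.

* ★★ `closes_split6` / `split6_of_closes` / `walkHardFJLinOdd_iff_residual6_split` / `walkHardFJLinOdd_iff_residual6`: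
  `T = WalkHardFJLinOdd ⟺ LOW-RESIDUAL⁶(dialB) ∧ RESIDUAL-HIGH⁶(dialB) ⟺ RESIDUAL⁶` BY NAME — the five decided dials AND the token dial
  absorbed; ★ `jlinLowResidual5_iff_lowResidual6`, `jlinResidualHigh5_iff_residualHigh6`: the two filed pieces of the RES⁵ split
  (items 27206, 27207) are, by name, EQUIVALENT to their six-dial residuals.
* ★★★ `residualHigh6_class_inhabited`: the hypothesis class of RESIDUAL-HIGH⁶ is INHABITED (`fieldY`, every prime `p ≥ 5`, eventually):
  `fieldY` escapes the token dial ROBUSTLY because every adjacency has swap mass `≥ 2ⁿ/2` in the strategy itself (`swapMass_fieldY_ge`),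
  while a dead pair of ANY presentation forces swap mass `0` (`swapMass_eq_zero_of_dead`) — a presentation-free certificate.
* `lowSide_class_inhabited` (critic wish 67v51 (w1)): the LOW side of the variation dial is trivially inhabited (the never-firing
  strategy: JLin-presentable with `J = ∅, a = 0`, swap mass `0` everywhere), so `LowSide B` / `LowResidual5Side B` quantify over a
  non-empty strategy class at the level of `JLinHyp ∧ LowVar`.

WHAT THIS IS NOT: a proof of either residual piece; no inhabitant of the LOW-RESIDUAL⁶ class is certified here (see the node memo: the
`(2,2,2,2,1)`-periodic one-column strategy is LOW and escapes the five decided dials but is CAUGHT by the token dial).  0 sorry.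
-/

set_option autoImplicit false

open Finset

namespace Summit.QuantumAdvantage.AdviceFreeQNC0.JLinPeel.TokenDial

open SegMove

variable {n : ℕ}

/-! ### (1) the six-dial split of T, by name -/

/-- ★★ **the DECIDING THEOREM of the six-dial split** (item vocabulary): LOW-RESIDUAL⁶ ∧ RESIDUAL-HIGH⁶ at schedule `dialB` close `T`. -/
theorem closes_split6 (hL : TowerDefs.LowResidual6Side TowerDefs.dialB) (hH : TowerDefs.ResidualHigh6Side TowerDefs.dialB) :
    Summit.QuantumAdvantage.QuantumAdvantage.Theses.CharDial.WalkHardFJLinOdd :=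
  TowerDefs.closes_split (lowResidual5_of_lowResidual6 _ hL) (residualHigh5_of_residualHigh6 _ hH)

/-- the six-dial split is EXACT: `T` gives both pieces back. -/
theorem split6_of_closes (hT : Summit.QuantumAdvantage.QuantumAdvantage.Theses.CharDial.WalkHardFJLinOdd) :
    TowerDefs.LowResidual6Side TowerDefs.dialB ∧ TowerDefs.ResidualHigh6Side TowerDefs.dialB :=
  let h := TowerDefs.split_of_closes hT
  ⟨lowResidual6_of_lowResidual5 _ h.1, residualHigh6_of_residualHigh5 _ h.2⟩

/-- ★★ **JUNCTION: T ⟺ LOW-RESIDUAL⁶ ∧ RESIDUAL-HIGH⁶**, every schedule `B`. -/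
theorem walkHardFJLinOdd_iff_residual6_split (B : ℕ → ℕ) :
    Summit.QuantumAdvantage.QuantumAdvantage.Theses.CharDial.WalkHardFJLinOdd ↔
      TowerDefs.LowResidual6Side B ∧ TowerDefs.ResidualHigh6Side B := by
  rw [TowerDefs.walkHardFJLinOdd_iff_residual5_split B, lowResidual5_iff_lowResidual6, residualHigh5_iff_residualHigh6]

/-- ★★ **JUNCTION: T ⟺ RESIDUAL⁶** (six dials absorbed). -/
theorem walkHardFJLinOdd_iff_residual6 :
    Summit.QuantumAdvantage.QuantumAdvantage.Theses.CharDial.WalkHardFJLinOdd ↔ TowerDefs.Residual6Side :=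
  TowerDefs.walkHardFJLinOdd_iff_residual5.trans residual5_iff_residual6

/-- ★ the filed LOW piece of the RES⁵ split (item stmt-QuantumAdvantage-27206, `JLinLowResidual5 := LowResidual5Side dialB` by name)
⟺ LOW-RESIDUAL⁶ at `dialB`. -/
theorem jlinLowResidual5_iff_lowResidual6 :
    Summit.QuantumAdvantage.QuantumAdvantage.Theses.CharDial.JLinLowResidual5 ↔ TowerDefs.LowResidual6Side TowerDefs.dialB :=
  lowResidual5_iff_lowResidual6 TowerDefs.dialB

/-- ★ the filed HIGH piece of the RES⁵ split (item stmt-QuantumAdvantage-27207, `JLinResidualHigh5 := ResidualHigh5Side dialB` by name)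
⟺ RESIDUAL-HIGH⁶ at `dialB`. -/
theorem jlinResidualHigh5_iff_residualHigh6 :
    Summit.QuantumAdvantage.QuantumAdvantage.Theses.CharDial.JLinResidualHigh5 ↔ TowerDefs.ResidualHigh6Side TowerDefs.dialB :=
  residualHigh5_iff_residualHigh6 TowerDefs.dialB

/-! ### (2) escaping the token dial: dead pairs have zero swap mass -/

section Escape

variable {p : ℕ} [hp : Fact p.Prime]

omit hp in
/-- a pair that is DEAD in a presentation has swap mass `0` in the presented strategy. -/
theorem swapMass_eq_zero_of_dead (D : JLinPeel.JLinData p n) (s t : Fin n) (hst : t.val = s.val + 1)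
    (hdead : ∀ g, D.a g s = D.a g t ∧ s ∉ D.J g ∧ t ∉ D.J g) : swapMass D.strat s.val = 0 := by
  unfold swapMass
  refine sum_eq_zero fun g _ => ?_
  exact swapInf_eq_zero D.strat g (D.J g) (D.a g) (D.h g) (D.hJ g) (fun u => rfl) s t hst
    (hdead g).1 (hdead g).2.1 (hdead g).2.2

omit hp in
/-- **presentation-free escape**: a strategy all of whose adjacencies have positive swap mass meets `TokenHyp` in NO presentation. -/
theorem not_tokenHyp_of_swapMass_pos (D : JLinPeel.JLinData p n)
    (hpos : ∀ s t : Fin n, t.val = s.val + 1 → 0 < swapMass D.strat s.val) : ¬ TowerDefs.TokenHyp D := by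
  rintro ⟨s, t, hst, hdead, -⟩
  exact absurd (swapMass_eq_zero_of_dead D s t hst hdead) (hpos s t hst).ne'

/-- **`fieldY` escapes the token dial in every presentation** (generic `α ≠ 0, 1`, HIGH-side budget). -/
theorem field_not_token (n K : ℕ) (hbig : p * (NullDial.sepM p n + (FieldCol.rk n + 1) * (K + 2)) ≤ n + 1) (hK : 1 ≤ K)
    (α : GaloisField p (FieldCol.rk n)) (h0 : α ≠ 0) (h1 : α ≠ 1)
    (D : JLinPeel.JLinData p n) (hD : D.strat = FieldCol.fieldY p n α) : ¬ TowerDefs.TokenHyp D := by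
  apply not_tokenHyp_of_swapMass_pos
  intro s t hst
  obtain ⟨r, hr⟩ := FieldCol.exists_col_jump p n α h0 h1 s t hst
  have h := FieldCol.swapMass_fieldY_ge p n K hbig α r s t hst hr
  rw [hD]
  have h2 : 2 ^ n ≤ K * 2 ^ n := Nat.le_mul_of_pos_left _ hK
  have h3 : 0 < 2 ^ n := Nat.two_pow_pos n
  omega

/-- ★★★ **`fieldY` in class(RESIDUAL-HIGH⁶), eventually** (every prime `p ≥ 5`): JLin-presentable (junta-free), HIGH at `dialB`, and in EVERY
`log₂ n`-junta presentation outside the rank, sparse, block, null, mask AND token dials. -/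
theorem fieldY_class6_eventually (hp5 : 5 ≤ p) : ∃ n₀ : ℕ, ∀ n ≥ n₀, ∃ α : GaloisField p (FieldCol.rk n),
    TowerDefs.JLinHyp p n (FieldCol.fieldY p n α) ∧ ¬ TowerDefs.LowVar TowerDefs.dialB n (FieldCol.fieldY p n α) ∧
    ∀ D : JLinPeel.JLinData p n, D.strat = FieldCol.fieldY p n α → (∀ g, (D.J g).card ≤ Nat.log 2 n) →
      ¬ TowerDefs.SpanHyp D ∧ ¬ TowerDefs.SparseHyp D ∧ ¬ TowerDefs.BlockHyp D ∧ ¬ TowerDefs.NullHyp D ∧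
        ¬ TowerDefs.MaskHyp D ∧ ¬ TowerDefs.TokenHyp D := by
  have hp3 : p % 3 = 1 ∨ p % 3 = 2 := Tower.mod3_of_prime_ge5 hp.out hp5
  obtain ⟨n₁, hn₁⟩ := FieldCol.eventually_fits p
  obtain ⟨n₂, hn₂⟩ := FieldCol.eventually_big p
  obtain ⟨n₃, hn₃⟩ := FieldCol.eventually_misc p
  obtain ⟨n₄, hn₄⟩ := FieldCol.field_not_span_eventually p
  refine ⟨max (max n₁ n₂) (max n₃ n₄), fun n hn => ?_⟩
  have hfit := hn₁ n (le_trans (le_trans (le_max_left _ _) (le_max_left _ _)) hn)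
  have hbig := hn₂ n (le_trans (le_trans (le_max_right _ _) (le_max_left _ _)) hn)
  obtain ⟨hpL, hpn, hn9⟩ := hn₃ n (le_trans (le_trans (le_max_left _ _) (le_max_right _ _)) hn)
  have hspan := hn₄ n (le_trans (le_trans (le_max_right _ _) (le_max_right _ _)) hn)
  obtain ⟨α, hα⟩ := FieldCol.exists_generic p n (by omega)
  have h0 : α ≠ 0 := FieldCol.generic_ne_zero p n (by omega) α hα
  have h1 : α ≠ 1 := FieldCol.generic_ne_one p n hpL hpn α hα
  have hL2 : 2 ≤ Nat.log 2 n := le_trans (by omega) hpL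
  refine ⟨α, ?_, FieldCol.not_low_fieldY p n _ hbig le_rfl (by omega) α h0 h1, fun D hD hJ => ?_⟩
  · intro g
    exact ⟨∅, by simp, (FieldCol.fieldData p n α).a g, (FieldCol.fieldData p n α).h g, fun _ _ _ _ => rfl, fun u => rfl⟩
  · have hM : ¬ TowerDefs.MaskHyp D := (Tower.maskHyp_iff_inlined D).not.mpr (FieldCol.field_not_mask p n hfit α hα D hD hJ)
    exact ⟨(Tower.spanHyp_iff_inlined D).not.mpr (hspan α D hD hJ),
      (Tower.sparseHyp_iff_inlined D).not.mpr (FieldCol.field_not_sparse p n hfit hL2 α D hD),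
      fun hB => hM (Tower.maskHyp_of_blockHyp hp3 D hB), fun hN => hM (Tower.maskHyp_of_nullHyp D hN), hM,
      field_not_token n _ hbig (by omega) α h0 h1 D hD⟩

/-- ★★★ **class(RESIDUAL-HIGH⁶) IS INHABITED** (item vocabulary): for every prime `p ≥ 5` and all large `n` some strategy satisfies the JLin
hypothesis, is HIGH at schedule `dialB`, and escapes all SIX dials in every `log₂ n`-junta ⊕ one-form presentation. -/
theorem residualHigh6_class_inhabited (p : ℕ) [Fact p.Prime] (hp5 : 5 ≤ p) :
    ∃ n₁ : ℕ, ∀ n ≥ n₁, ∃ y : Fin (n + 1) → (Fin n → Bool) → Bool,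
      TowerDefs.JLinHyp p n y ∧ ¬ TowerDefs.LowVar TowerDefs.dialB n y ∧
      ∀ D : JLinPeel.JLinData p n, D.strat = y → (∀ g, (D.J g).card ≤ Nat.log 2 n) →
        ¬ TowerDefs.SpanHyp D ∧ ¬ TowerDefs.SparseHyp D ∧ ¬ TowerDefs.BlockHyp D ∧ ¬ TowerDefs.NullHyp D ∧
          ¬ TowerDefs.MaskHyp D ∧ ¬ TowerDefs.TokenHyp D := by
  obtain ⟨n₀, h⟩ := fieldY_class6_eventually (p := p) hp5
  exact ⟨n₀, fun n hn => let ⟨α, hy, hV, hesc⟩ := h n hn; ⟨FieldCol.fieldY p n α, hy, hV, hesc⟩⟩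

/-- ★ **RESIDUAL-HIGH⁶ is tested NON-VACUOUSLY**: a purported `ResidualHigh6Side dialB` bound applies to an actual member of its class. -/
theorem residualHigh6_nonvacuous (hR : TowerDefs.ResidualHigh6Side TowerDefs.dialB) (p : ℕ) [Fact p.Prime] (hp5 : 5 ≤ p) :
    ∃ θ : ℝ, θ < 1 ∧ ∃ n₀ : ℕ, ∀ n ≥ n₀, ∃ y : Fin (n + 1) → (Fin n → Bool) → Bool,
      TowerDefs.JLinHyp p n y ∧ ¬ TowerDefs.LowVar TowerDefs.dialB n y ∧ ∀ c : ℕ,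
        ((Finset.univ.filter fun u : Fin n → Bool => ringWinU c y u = true).card : ℝ) ≤ θ * (2 : ℝ) ^ n := by
  obtain ⟨θ, hθ, n₀, h⟩ := hR p hp5
  obtain ⟨n₁, h₁⟩ := residualHigh6_class_inhabited p hp5
  refine ⟨θ, hθ, max n₀ n₁, fun n hn => ?_⟩
  obtain ⟨y, hy, hV, hesc⟩ := h₁ n (le_trans (le_max_right _ _) hn)
  exact ⟨y, hy, hV, fun c => h n (le_trans (le_max_left _ _) hn) c y hy hV hesc⟩

end Escape

/-! ### (3) the LOW side is inhabited (critic 67v51 (w1)) -/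

/-- the never-firing strategy has swap mass `0` at every position. -/
theorem swapMass_const_false (i : ℕ) : swapMass (fun (_ : Fin (n + 1)) (_ : Fin n → Bool) => false) i = 0 := by
  unfold swapMass swapInf
  simp

/-- ★ **class(LOW side) IS INHABITED, every `p`, `n`, schedule `B`**: the never-firing strategy is JLin-presentable (`J = ∅`, `a = 0`, constant
table) and every position is LOW for it.  (So `LowSide B`, `LowResidual5Side B`, `LowResidual6Side B` quantify, at the level of their first two
hypotheses `JLinHyp ∧ LowVar`, over a non-empty class; which members ALSO escape the decided dials is the open content of the LOW piece.) -/
theorem lowSide_class_inhabited (p n : ℕ) (B : ℕ → ℕ) :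
    ∃ y : Fin (n + 1) → (Fin n → Bool) → Bool, TowerDefs.JLinHyp p n y ∧ TowerDefs.LowVar B n y := by
  refine ⟨fun _ _ => false, fun g => ⟨∅, by simp, fun _ => 0, fun _ _ => false, fun _ _ _ _ => rfl, fun _ => rfl⟩, ?_⟩
  show n ≤ 2 * (lowPositions n (fun (_ : Fin (n + 1)) (_ : Fin n → Bool) => false) (B n)).card
  have h : lowPositions n (fun (_ : Fin (n + 1)) (_ : Fin n → Bool) => false) (B n) = range n := by
    unfold lowPositions
    apply filter_true_of_mem
    intro i _
    rw [swapMass_const_false]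
    exact Nat.zero_le _
  rw [h, card_range]
  omega

/-- the never-firing strategy wins on NO input (so it is no counterexample to anything): `ringWinU c (fun _ _ => false) u = false`. -/
theorem ringWinU_const_false (c : ℕ) (u : Fin n → Bool) :
    ringWinU c (fun (_ : Fin (n + 1)) (_ : Fin n → Bool) => false) u = false := by
  rw [SegMove.ringWinU_eq_decide]
  simp [SegMove.flc]

end Summit.QuantumAdvantage.AdviceFreeQNC0.JLinPeel.TokenDial
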